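import Literature.AlgebraicGeometry.Resolution.DecompletionHenselPoint
import Literature.AlgebraicGeometry.Resolution.DecompletionPolydisc
import HarnessLib

/-!
# Temkin's decompletion lemma, algebraic proof — XI. The Newton coordinate `W_D` inside the Hensel chart

Topic: `Literature/AlgebraicGeometry/Resolution`. M. Temkin, *Inseparable local uniformization*,
J. Algebra 373 (2013) 65–119 = arXiv:0804.1554v3, Lemma 3.3.2 (tree: `Temkin2013_Lemma332_nft`).

The `m`-side of the Hensel chart `D₀` (`DecompletionHenselPoint.lean`: `Ξ`, `θ₀`) continued:

* `exists_poly` (every `ν ∈ m` is `Θ(y₀)/π^d` with `Θ ∈ k°[Y]`), `θ₀_y₀ = ζ`, `Ξ_aeval_y₀`,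
  `σDr_θ₀` (`σ_D ∘ θ₀ = id` on integral elements) — PROVED;
* the polydisc coordinates `uD i = Tᵢ/π^{j_z} ∈ A″_j` (`πK_pow_mul_uD`, value `0`) — PROVED;
* the `w`-data: `Θw, dΘ` (`Θ_w(y₀) = π^{d_Θ} w₀′`), `gw = π^{d_Θ} w′ − Θ_w(y)` (vanishing at the
  point), its linear smallness `bw, γw` (`DecompletionZoomRings.exists_small`), `Qw`, `dZ`, `Bw`,
  the honest preimage `Δw ∈ D₀` of `ι_K(π^{d_Θ}w′) − Ξ(π^{d_Θ}w₀′)` (`ιD_Δw`) and its smallness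
  `Δw ∈ π^{j−B_w} D₀` (`Δw_small`), `σ_D(Δ_w) = 0` — PROVED;
* **the Newton coordinate** `WD (r) ∈ D₀` with **(I′)** `π^{N₀+r+d_Θ} W_D = Δ_w θ₀(ι₀)`
  (`WD_spec`), `σ_D(W_D) = 0` and **(b)** `π^r Ξ(c₀′) ι_D(W_D) = ι_K(w′) − Ξ(w₀′)` (`ιD_WD`) —
  PROVED.

All statements are [folklore]; no named facts.

## Sources

* M. Temkin, arXiv:0804.1554v3, proof of Lemma 3.3.2 (pp. 45–46).
-/

noncomputable section

open Polynomial

namespace Literature.AlgebraicGeometry.Resolution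

universe u

variable {k K m : Type u} [Field k] [Field K] [Algebra k K] [Field m] [Algebra k m]

/-! ## The `m`-side of the Hensel chart, II: `θ` on integral elements, the coordinate `W_D` -/

namespace DecompChart

variable {V : ValuationSubring k} {O : ValuationSubring m} {A : Subring K}
  {φ : Algebra.adjoin k (A : Set K) →ₐ[k] m} (C : DecompChart V O A φ)

section MSide

variable (e : ℕ) {j : ℕ} (hj : C.jH ≤ j) (hje : C.bp + e + 2 * C.Na ≤ j)

/-! ### Polynomial representatives of elements of `m` through the primitive element `y₀` -/

/-- Uniform clearing of denominators for a one-variable polynomial over `k`. [folklore] -/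
theorem exists_pow_mul_coeff_mem_V (q : k[X]) : ∃ N : ℕ, ∀ i, C.π ^ N * q.coeff i ∈ V := by
  classical
  have hmono : ∀ {z : k} {a b : ℕ}, a ≤ b → C.π ^ a * z ∈ V → C.π ^ b * z ∈ V := by
    intro z a b hab h
    obtain ⟨c, rfl⟩ := Nat.exists_eq_add_of_le hab
    rw [add_comm, pow_add, mul_assoc]
    exact mul_mem (pow_mem C.hπV c) h
  choose N hN using fun i => exists_pow_mul_mem_of_ringKrullDim_eq_one V C.hdim C.hπV C.hπlt (q.coeff i)
  refine ⟨q.support.sup N, fun i => ?_⟩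
  by_cases hi : i ∈ q.support
  · exact hmono (Finset.le_sup hi) (hN i)
  · rw [Polynomial.notMem_support_iff.mp hi, mul_zero]; exact V.zero_mem

/-- **Every element of `m` is `Θ(y₀)/π^d` for a `k°`-polynomial `Θ`.** [folklore] -/
theorem exists_poly (ν : m) : ∃ (Θ : V[X]) (d : ℕ),
    Polynomial.aeval C.y₀ (Θ.map (algebraMap V k)) = algebraMap k m C.π ^ d * ν := by
  obtain ⟨q₀, hq₀⟩ := C.adjoinRootToM_bijective.2 ν
  obtain ⟨q, rfl⟩ := AdjoinRoot.mk_surjective q₀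
  rw [adjoinRootToM, AdjoinRoot.liftAlgHom_mk] at hq₀
  -- `hq₀ : q(y₀) = ν`; clear denominators: `π^d q` has coefficients in `k°`
  obtain ⟨d, hd⟩ := C.exists_pow_mul_coeff_mem_V q
  have hl : Polynomial.C (C.π ^ d) * q ∈ Polynomial.lifts (algebraMap V k) := by
    rw [Polynomial.lifts_iff_coeff_lifts]
    intro i
    rw [Polynomial.coeff_C_mul]
    exact ⟨⟨_, hd i⟩, rfl⟩
  obtain ⟨Θ, hΘ⟩ := (Polynomial.mem_lifts _).mp hl
  refine ⟨Θ, d, ?_⟩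
  rw [hΘ, map_mul, Polynomial.aeval_C, map_pow, ← hq₀]
  rfl

/-! ### `θ₀` on `k°`-polynomial expressions, `θ₀(y₀) = ζ`, `σ_D ∘ θ₀ = id` -/

/-- `θ₀(y₀) = ζ`. [folklore] -/
theorem θ₀_y₀ : C.θ₀ e hj hje C.y₀_isIntegral = C.ζ e hj hje :=
  C.ιD_injective e hj hje (by rw [C.ιD_θ₀, C.Ξ_y₀])

/-- `Ξ` of a `k°`-polynomial expression in `y₀` is `ι_D` of the same expression in `ζ`. [folklore] -/
theorem Ξ_aeval_y₀ (Θ : V[X]) :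
    C.Ξ e hj hje (Polynomial.aeval C.y₀ (Θ.map (algebraMap V k))) =
      C.ιD e hj hje (Polynomial.aeval (C.ζ e hj hje)
        (Θ.map ((algebraMap (C.A'' hj) (C.D₀ e hj hje)).comp (C.baseToA'' hj)))) := by
  have hcomp : (C.Ξ e hj hje).comp ((algebraMap k m).comp (algebraMap V k)) =
      (C.ιD e hj hje : C.D₀ e hj hje →+* C.ΩD e hj hje).comp
        ((algebraMap (C.A'' hj) (C.D₀ e hj hje)).comp (C.baseToA'' hj)) := by
    ext v
    simp only [RingHom.coe_comp, Function.comp_apply]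
    exact C.Ξ_algebraMap_V e hj hje v
  -- left side to the common form
  rw [Polynomial.aeval_def, Polynomial.eval₂_map, Polynomial.hom_eval₂, C.Ξ_y₀, hcomp]
  -- right side
  rw [Polynomial.aeval_def, Polynomial.eval₂_map, Algebra.algebraMap_self, RingHom.id_comp,
    show (C.ιD e hj hje) (C.ζ e hj hje) = (C.ιD e hj hje : C.D₀ e hj hje →+* C.ΩD e hj hje) (C.ζ e hj hje)
      from rfl, ← Polynomial.hom_eval₂]
  rfl

/-- The value at the point of a `k°`-polynomial expression in `ζ`: the same expression in `y₀`.
[folklore] -/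
theorem σDr_aeval_ζ (Θ : V[X]) :
    (C.σDr e hj hje (Polynomial.aeval (C.ζ e hj hje)
      (Θ.map ((algebraMap (C.A'' hj) (C.D₀ e hj hje)).comp (C.baseToA'' hj)))) : m) =
      Polynomial.aeval C.y₀ (Θ.map (algebraMap V k)) := by
  have hcomp : (O.subtype.comp (C.σDr e hj hje)).comp
      ((algebraMap (C.A'' hj) (C.D₀ e hj hje)).comp (C.baseToA'' hj)) =
      (algebraMap k m).comp (algebraMap V k) := by
    ext v
    change ((C.σDr e hj hje (algebraMap (C.A'' hj) (C.D₀ e hj hje) (C.baseToA'' hj v)) : O) : m) =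
      algebraMap k m (v : k)
    rw [σDr_algebraMap, baseToA''_apply_coe, ev_algebraMap]
  rw [Polynomial.aeval_def, Polynomial.eval₂_map, Algebra.algebraMap_self, RingHom.id_comp]
  change O.subtype ((C.σDr e hj hje) (Polynomial.eval₂ _ (C.ζ e hj hje) Θ)) = _
  rw [← RingHom.comp_apply, Polynomial.hom_eval₂, hcomp, RingHom.comp_apply,
    show O.subtype (C.σDr e hj hje (C.ζ e hj hje)) = C.y₀ from C.σDr_ζ e hj hje,
    Polynomial.aeval_def, Polynomial.eval₂_map]

/-- **`σ_D ∘ θ₀ = id` on integral elements** (compare `π^d θ₀(ν)` with `Θ(ζ)`). [folklore] -/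
theorem σDr_θ₀ {ν : m} (hν : IsIntegral (baseRing m V) ν) :
    (C.σDr e hj hje (C.θ₀ e hj hje hν) : m) = ν := by
  obtain ⟨Θ, d, hΘ⟩ := C.exists_poly ν
  -- `π^d θ₀ ν = Θ(ζ)` in `D₀`
  have key : algebraMap (C.A'' hj) (C.D₀ e hj hje) (C.πS hj ^ d) * C.θ₀ e hj hje hν =
      Polynomial.aeval (C.ζ e hj hje)
        (Θ.map ((algebraMap (C.A'' hj) (C.D₀ e hj hje)).comp (C.baseToA'' hj))) := by
    apply C.ιD_injective e hj hje
    rw [map_mul, C.ιD_θ₀, ← C.Ξ_aeval_y₀, hΘ, map_mul, ← C.ιK_coe, SubmonoidClass.coe_pow, map_pow,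
      map_pow, show (C.πS hj : K) = algebraMap k K C.π from rfl, ← C.Ξ_algebraMap e hj hje]
  have h := congrArg (fun x => (C.σDr e hj hje x : m)) key
  simp only [map_mul, map_pow, MulMemClass.coe_mul, SubmonoidClass.coe_pow] at h
  rw [σDr_algebraMap, C.σDr_aeval_ζ, hΘ, show (C.πS hj : K) = C.πK from rfl, ev_πK] at h
  exact mul_left_cancel₀ (pow_ne_zero d ((_root_.map_ne_zero _).mpr C.hπ0)) h

/-! ### The polydisc coordinates in the Hensel chart -/

variable (jz : ℕ) (hjc : jz + C.c = j)

/-- The polydisc coordinate `u′ᵢ = Tᵢ/π^{j_z} = uᵢ h^{−L} ∈ A″_j`. [folklore] -/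
def uD (i : Fin C.n) : C.A'' hj :=
  ⟨C.u j i * (C.h⁻¹) ^ C.L, C.A''₀_le_A'' hj (Subring.mul_mem _
    (C.u_mem_A''₀ (le_trans C.j₀_le_jH hj) i)
    (Subring.pow_mem _ (C.h_inv_mem_A''₀ (le_trans C.j₀_le_jH hj)) _))⟩

include hjc in
/-- `π^{j_z} u′ᵢ = Tᵢ` in `K`. [folklore] -/
theorem πK_pow_mul_uD (i : Fin C.n) : C.πK ^ jz * (C.uD hj i : K) = C.T i := by
  subst hjc
  change C.πK ^ jz * (C.u (jz + C.c) i * (C.h⁻¹) ^ C.L) = C.T i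
  have h1 : C.πK ^ (jz + C.c) * C.u (jz + C.c) i = C.πK ^ C.c * (C.h ^ C.L * C.T i) := by
    rw [← C.τ_eq_pow_mul_u (jz + C.c) i]; rfl
  rw [pow_add, mul_comm (C.πK ^ jz), mul_assoc] at h1
  have h2 : C.πK ^ jz * C.u (jz + C.c) i = C.h ^ C.L * C.T i :=
    mul_left_cancel₀ (pow_ne_zero _ C.πK_ne_zero) h1
  rw [← mul_assoc, h2, inv_pow, mul_comm (C.h ^ C.L), mul_assoc, mul_inv_cancel₀ (pow_ne_zero _ C.hh0),
    mul_one]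

/-- `u′ᵢ(x) = 0`. [folklore] -/
theorem ev_uD (i : Fin C.n) : ev φ (C.uD hj i : K) = 0 := by
  change ev φ (C.u j i * (C.h⁻¹) ^ C.L) = 0
  rw [ev_mul φ (C.A''₀_subset_Rx (le_trans C.j₀_le_jH hj) (C.u_mem_A''₀ (le_trans C.j₀_le_jH hj) i))
    (C.A''₀_subset_Rx (le_trans C.j₀_le_jH hj) (Subring.pow_mem _
      (C.h_inv_mem_A''₀ (le_trans C.j₀_le_jH hj)) _)), C.ev_u, zero_mul]

/-- `σ_D(u′ᵢ) = 0`. [folklore] -/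
@[simp] theorem σDr_uD (i : Fin C.n) :
    C.σDr e hj hje (algebraMap (C.A'' hj) (C.D₀ e hj hje) (C.uD hj i)) = 0 :=
  Subtype.ext (by rw [σDr_algebraMap, ev_uD]; rfl)

/-! ### The data of the Newton coordinate `W_D` -/

/-- The polynomial `Θ_w` and exponent `d_Θ` with `Θ_w(y₀) = π^{d_Θ} w₀′`. [folklore] -/
theorem exists_Θw : ∃ (Θ : V[X]) (d : ℕ),
    Polynomial.aeval C.y₀ (Θ.map (algebraMap V k)) = algebraMap k m C.π ^ d * C.w₀' := C.exists_poly C.w₀'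

/-- `Θ_w`. [folklore] -/
def Θw : V[X] := C.exists_Θw.choose

/-- `d_Θ`. [folklore] -/
def dΘ : ℕ := C.exists_Θw.choose_spec.choose

/-- `Θ_w(y₀) = π^{d_Θ} w₀′`. [folklore] -/
theorem aeval_y₀_Θw : Polynomial.aeval C.y₀ (C.Θw.map (algebraMap V k)) =
    algebraMap k m C.π ^ C.dΘ * C.w₀' := C.exists_Θw.choose_spec.choose_spec

/-- The function `g_w = π^{d_Θ} w′ − Θ_w(y) ∈ Rh`, vanishing at the point. [folklore] -/
def gw : K := C.πK ^ C.dΘ * (C.w' : K) - Polynomial.aeval C.y (C.Θw.map (algebraMap V k))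

/-- `g_w ∈ Rh`. [folklore] -/
theorem gw_mem_Rh : C.gw ∈ C.Rh := by
  refine C.Rh.sub_mem (C.Rh.mul_mem (C.Rh.pow_mem (C.A₀_subset_Rh C.πK_mem_A₀) _) C.w'.2) ?_
  exact C.A₀_subset_Rh (C.aeval_mem_A₀ C.y_mem_A₀ fun i => by
    rw [Polynomial.coeff_map]; exact (C.Θw.coeff i).2)

/-- `g_w(x) = 0`. [folklore] -/
theorem ev_gw : ev φ C.gw = 0 := by
  have hw : ((C.w' : C.Rh) : K) ∈ Rx φ := C.Rh_le_Rx C.w'.2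
  have hΘ : Polynomial.aeval C.y (C.Θw.map (algebraMap V k)) ∈ Rx φ :=
    C.A₀_subset_Rx (C.aeval_mem_A₀ C.y_mem_A₀ fun i => by
      rw [Polynomial.coeff_map]; exact (C.Θw.coeff i).2)
  rw [gw, ev_sub φ ((Rx φ).mul_mem ((Rx φ).pow_mem (C.A₀_subset_Rx C.πK_mem_A₀) _) hw) hΘ,
    ev_mul φ ((Rx φ).pow_mem (C.A₀_subset_Rx C.πK_mem_A₀) _) hw, ev_pow φ (C.A₀_subset_Rx C.πK_mem_A₀),
    ev_πK, ev_aeval φ C.y_mem_Rx, C.ev_of_mem C.w'.2, show C.φh ⟨(C.w' : K), C.w'.2⟩ = C.w₀' from rfl,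
    show ev φ C.y = C.y₀ from rfl, C.aeval_y₀_Θw, sub_self]

/-- The exponent `b_w` of the linear smallness of `g_w`. [folklore] -/
theorem exists_bw : ∃ b : ℕ, ∀ (j : ℕ) (hj : C.j₀ ≤ j), b ≤ j →
    ∃ γ ∈ C.A''₀ hj, C.πK ^ b * C.gw = C.πK ^ j * γ := C.exists_small C.gw_mem_Rh C.ev_gw

/-- `b_w`. [folklore] -/
def bw : ℕ := C.exists_bw.choose

/-- `γ_w ∈ A″₀_j` with `π^{b_w} g_w = π^j γ_w`. [folklore] -/
theorem exists_γw (hbw : C.bw ≤ j) : ∃ γ ∈ C.A''₀ (le_trans C.j₀_le_jH hj),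
    C.πK ^ C.bw * C.gw = C.πK ^ j * γ := C.exists_bw.choose_spec j _ hbw

/-- `γ_w`. [folklore] -/
def γw (hbw : C.bw ≤ j) : K := (C.exists_γw hj hbw).choose

/-- `γ_w ∈ A″₀_j`. [folklore] -/
theorem γw_mem (hbw : C.bw ≤ j) : C.γw hj hbw ∈ C.A''₀ (le_trans C.j₀_le_jH hj) :=
  (C.exists_γw hj hbw).choose_spec.1

/-- `π^{b_w} g_w = π^j γ_w`. [folklore] -/
theorem γw_spec (hbw : C.bw ≤ j) : C.πK ^ C.bw * C.gw = C.πK ^ j * C.γw hj hbw :=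
  (C.exists_γw hj hbw).choose_spec.2

/-- `g_w = π^{j−b_w} γ_w`. [folklore] -/
theorem gw_eq (hbw : C.bw ≤ j) : C.gw = C.πK ^ (j - C.bw) * C.γw hj hbw := by
  apply mul_left_cancel₀ (pow_ne_zero C.bw C.πK_ne_zero)
  rw [C.γw_spec hj hbw, ← mul_assoc, ← pow_add, Nat.add_sub_cancel' hbw]

/-- `γ_w(x) = 0`. [folklore] -/
theorem ev_γw (hbw : C.bw ≤ j) : ev φ (C.γw hj hbw) = 0 := by
  have h := congrArg (ev φ) (C.γw_spec hj hbw)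
  rw [ev_mul φ ((Rx φ).pow_mem (C.A₀_subset_Rx C.πK_mem_A₀) _) (C.Rh_le_Rx C.gw_mem_Rh), C.ev_gw,
    mul_zero, ev_mul φ ((Rx φ).pow_mem (C.A₀_subset_Rx C.πK_mem_A₀) _)
      (C.A''₀_subset_Rx _ (C.γw_mem hj hbw)), ev_pow φ (C.A₀_subset_Rx C.πK_mem_A₀), ev_πK] at h
  exact (mul_eq_zero.mp h.symm).resolve_left (pow_ne_zero _ ((_root_.map_ne_zero _).mpr C.hπ0))

/-- `γ_w` as an element of `A″_j`. [folklore] -/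
def γwS (hbw : C.bw ≤ j) : C.A'' hj := ⟨C.γw hj hbw, C.A''₀_le_A'' hj (C.γw_mem hj hbw)⟩

/-- `Θ_w` over `D₀`. [folklore] -/
def ΘwD : (C.D₀ e hj hje)[X] :=
  C.Θw.map ((algebraMap (C.A'' hj) (C.D₀ e hj hje)).comp (C.baseToA'' hj))

/-- The quotient `Q_w` with `Θ_w(y) − Θ_w(ζ) = (y − ζ) Q_w` in `D₀`. [folklore] -/
theorem exists_Qw : ∃ Q : C.D₀ e hj hje,
    (C.ΘwD e hj hje).eval (algebraMap (C.A'' hj) (C.D₀ e hj hje) (C.yS hj)) - (C.ΘwD e hj hje).eval (C.ζ e hj hje) =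
      (algebraMap (C.A'' hj) (C.D₀ e hj hje) (C.yS hj) - C.ζ e hj hje) * Q :=
  Polynomial.sub_dvd_eval_sub _ _ _

/-- `Q_w`. [folklore] -/
def Qw : C.D₀ e hj hje := (C.exists_Qw e hj hje).choose

/-- Defining property of `Q_w`. [folklore] -/
theorem Qw_spec : (C.ΘwD e hj hje).eval (algebraMap (C.A'' hj) (C.D₀ e hj hje) (C.yS hj)) -
    (C.ΘwD e hj hje).eval (C.ζ e hj hje) =
      (algebraMap (C.A'' hj) (C.D₀ e hj hje) (C.yS hj) - C.ζ e hj hje) * C.Qw e hj hje :=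
  (C.exists_Qw e hj hje).choose_spec

/-- `d_Z` with `Z = π^{j−b_p−e−2N_a} d_Z`. [folklore] -/
def dZ : C.D₀ e hj hje := (C.Z_small e hj hje).choose

/-- Defining property of `d_Z`. [folklore] -/
theorem dZ_spec : C.Z e hj hje =
    algebraMap (C.A'' hj) (C.D₀ e hj hje) (C.πS hj ^ (j - C.bp - e - 2 * C.Na)) * C.dZ e hj hje :=
  (C.Z_small e hj hje).choose_spec

/-- The exponent `B_w = max(b_w, b_p + 2N_a)`. [folklore] -/
def Bw : ℕ := max C.bw (C.bp + 2 * C.Na)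

/-- `b_w ≤ B_w`. [folklore] -/
theorem bw_le_Bw : C.bw ≤ C.Bw := le_max_left _ _

/-- `b_p + 2N_a ≤ B_w`. [folklore] -/
theorem bp_le_Bw : C.bp + 2 * C.Na ≤ C.Bw := le_max_right _ _

variable (hBw : C.Bw ≤ j)

/-- **The honest preimage `Δ_w ∈ D₀` of `ι_K(π^{d_Θ} w′) − Ξ(π^{d_Θ} w₀′)`**:
`Δ_w = π^{j−b_w} γ_w + (Θ_w(y) − Θ_w(ζ))`. [folklore] -/
def Δw : C.D₀ e hj hje :=
  algebraMap (C.A'' hj) (C.D₀ e hj hje) (C.πS hj ^ (j - C.bw) * C.γwS hj (le_trans C.bw_le_Bw hBw)) +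
    ((C.ΘwD e hj hje).eval (algebraMap (C.A'' hj) (C.D₀ e hj hje) (C.yS hj)) -
      (C.ΘwD e hj hje).eval (C.ζ e hj hje))

/-- `ι_D(Θ_w(y)) = ι_K(Θ_w(y))`. [folklore] -/
theorem ιD_eval_ΘwD_yS : C.ιD e hj hje ((C.ΘwD e hj hje).eval (algebraMap (C.A'' hj) (C.D₀ e hj hje) (C.yS hj))) =
    C.ιK e hj hje (Polynomial.aeval C.y (C.Θw.map (algebraMap V k))) := by
  have hcomp : (C.ιD e hj hje : C.D₀ e hj hje →+* C.ΩD e hj hje).comp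
      ((algebraMap (C.A'' hj) (C.D₀ e hj hje)).comp (C.baseToA'' hj)) =
      (C.ιK e hj hje : K →+* C.ΩD e hj hje).comp ((algebraMap k K).comp (algebraMap V k)) := by
    ext v
    change C.ιD e hj hje (algebraMap _ _ (C.baseToA'' hj v)) = C.ιK e hj hje (algebraMap k K (v : k))
    rw [← C.ιK_coe]; rfl
  have hpt : (C.ιD e hj hje : C.D₀ e hj hje →+* C.ΩD e hj hje) (algebraMap _ _ (C.yS hj)) =
      (C.ιK e hj hje : K →+* C.ΩD e hj hje) C.y := by
    change C.ιD e hj hje (algebraMap _ _ (C.yS hj)) = C.ιK e hj hje C.y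
    rw [← C.ιK_coe]; rfl
  rw [ΘwD, Polynomial.eval_map,
    show (C.ιD e hj hje) (Polynomial.eval₂ _ _ C.Θw) = (C.ιD e hj hje : C.D₀ e hj hje →+* C.ΩD e hj hje)
      (Polynomial.eval₂ _ _ C.Θw) from rfl, Polynomial.hom_eval₂, hcomp, hpt, ← Polynomial.hom_eval₂,
    Polynomial.aeval_def, Polynomial.eval₂_map]
  rfl

/-- `ι_D(Θ_w(ζ)) = Ξ(π^{d_Θ} w₀′)`. [folklore] -/
theorem ιD_eval_ΘwD_ζ : C.ιD e hj hje ((C.ΘwD e hj hje).eval (C.ζ e hj hje)) =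
    C.Ξ e hj hje (algebraMap k m C.π ^ C.dΘ * C.w₀') := by
  rw [← C.aeval_y₀_Θw, C.Ξ_aeval_y₀, ΘwD, Polynomial.coe_aeval_eq_eval]

/-- **`ι_D(Δ_w) = ι_K(π^{d_Θ} w′) − Ξ(π^{d_Θ} w₀′)`.** [folklore] -/
theorem ιD_Δw : C.ιD e hj hje (C.Δw e hj hje hBw) =
    C.ιK e hj hje (C.πK ^ C.dΘ * (C.w' : K)) - C.Ξ e hj hje (algebraMap k m C.π ^ C.dΘ * C.w₀') := by
  rw [Δw, map_add, map_sub, C.ιD_eval_ΘwD_yS, C.ιD_eval_ΘwD_ζ, ← C.ιK_coe, Subring.coe_mul,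
    SubmonoidClass.coe_pow, show ((C.πS hj : C.A'' hj) : K) = C.πK from rfl, γwS,
    ← C.gw_eq hj (le_trans C.bw_le_Bw hBw), gw, map_sub]
  ring

include hje in
/-- **`Δ_w` is small**: `Δ_w ∈ π^{j−B_w} D₀`. [folklore] -/
theorem Δw_small : ∃ x : C.D₀ e hj hje,
    C.Δw e hj hje hBw = algebraMap (C.A'' hj) (C.D₀ e hj hje) (C.πS hj) ^ (j - C.Bw) * x := by
  have h1 : j - C.bw = (j - C.Bw) + (C.Bw - C.bw) := by have := C.bw_le_Bw; omega
  have h2 : e + (j - C.bp - e - 2 * C.Na) = (j - C.Bw) + (C.Bw - (C.bp + 2 * C.Na)) := by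
    have := C.bp_le_Bw; omega
  refine ⟨algebraMap (C.A'' hj) (C.D₀ e hj hje) (C.πS hj ^ (C.Bw - C.bw) * C.γwS hj (le_trans C.bw_le_Bw hBw)) -
    algebraMap (C.A'' hj) (C.D₀ e hj hje) (C.πS hj ^ (C.Bw - (C.bp + 2 * C.Na)) *
      ⟨C.ay, C.A₀_subset_A'' hj C.ay_mem_A₀⟩) * C.dZ e hj hje * C.Qw e hj hje, ?_⟩
  have hζ : algebraMap (C.A'' hj) (C.D₀ e hj hje) (C.yS hj) - C.ζ e hj hje =
      -(algebraMap (C.A'' hj) (C.D₀ e hj hje) (C.δS e hj) * C.Z e hj hje) := by rw [ζ]; ring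
  have hδ : C.δS e hj = C.πS hj ^ e * ⟨C.ay, C.A₀_subset_A'' hj C.ay_mem_A₀⟩ := Subtype.ext rfl
  rw [Δw, C.Qw_spec, hζ, C.dZ_spec, hδ, h1]
  conv_lhs => rw [show (C.πS hj ^ e * (⟨C.ay, C.A₀_subset_A'' hj C.ay_mem_A₀⟩ : C.A'' hj)) = 
    ⟨C.ay, C.A₀_subset_A'' hj C.ay_mem_A₀⟩ * C.πS hj ^ e from mul_comm _ _]
  simp only [map_mul, map_pow, pow_add]
  have h3 : algebraMap (C.A'' hj) (C.D₀ e hj hje) (C.πS hj) ^ e *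
      algebraMap (C.A'' hj) (C.D₀ e hj hje) (C.πS hj) ^ (j - C.bp - e - 2 * C.Na) =
      algebraMap (C.A'' hj) (C.D₀ e hj hje) (C.πS hj) ^ (j - C.Bw) *
        algebraMap (C.A'' hj) (C.D₀ e hj hje) (C.πS hj) ^ (C.Bw - (C.bp + 2 * C.Na)) := by
    rw [← pow_add, ← pow_add, h2]
  linear_combination (-(algebraMap (C.A'' hj) (C.D₀ e hj hje)) ⟨C.ay, C.A₀_subset_A'' hj C.ay_mem_A₀⟩ *
    C.dZ e hj hje * C.Qw e hj hje) * h3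

/-- The point kills `Θ_w(y) − Θ_w(ζ)`. [folklore] -/
theorem σDr_eval_ΘwD_sub : C.σDr e hj hje ((C.ΘwD e hj hje).eval (algebraMap (C.A'' hj) (C.D₀ e hj hje) (C.yS hj)) -
    (C.ΘwD e hj hje).eval (C.ζ e hj hje)) = 0 := by
  have hpt : C.σDr e hj hje (algebraMap (C.A'' hj) (C.D₀ e hj hje) (C.yS hj)) = C.σDr e hj hje (C.ζ e hj hje) := by
    apply Subtype.ext; rw [σDr_algebraMap, C.σDr_ζ]; rfl
  rw [map_sub, sub_eq_zero,
    show (C.ΘwD e hj hje).eval (algebraMap (C.A'' hj) (C.D₀ e hj hje) (C.yS hj)) =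
      (C.ΘwD e hj hje).eval₂ (RingHom.id _) (algebraMap (C.A'' hj) (C.D₀ e hj hje) (C.yS hj)) from rfl,
    show (C.ΘwD e hj hje).eval (C.ζ e hj hje) = (C.ΘwD e hj hje).eval₂ (RingHom.id _) (C.ζ e hj hje) from rfl,
    Polynomial.hom_eval₂, Polynomial.hom_eval₂, hpt]

include hje in
/-- `σ_D(Δ_w) = 0`. [folklore] -/
theorem σDr_Δw : C.σDr e hj hje (C.Δw e hj hje hBw) = 0 := by
  rw [Δw, map_add, C.σDr_eval_ΘwD_sub, add_zero]
  apply Subtype.ext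
  rw [σDr_algebraMap, ZeroMemClass.coe_zero, Subring.coe_mul, SubmonoidClass.coe_pow,
    ev_mul φ ((Rx φ).pow_mem (C.A''_subset_Rx hj (C.πS hj).2) _) (C.A''_subset_Rx hj (C.γwS hj _).2),
    show ((C.γwS hj (le_trans C.bw_le_Bw hBw) : C.A'' hj) : K) = C.γw hj (le_trans C.bw_le_Bw hBw) from rfl,
    C.ev_γw, mul_zero]

/-- `x_Δ` with `Δ_w = π^{j−B_w} x_Δ`. [folklore] -/
def xΔ : C.D₀ e hj hje := (C.Δw_small e hj hje hBw).choose

/-- Defining property of `x_Δ`. [folklore] -/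
theorem xΔ_spec : C.Δw e hj hje hBw =
    algebraMap (C.A'' hj) (C.D₀ e hj hje) (C.πS hj) ^ (j - C.Bw) * C.xΔ e hj hje hBw :=
  (C.Δw_small e hj hje hBw).choose_spec

/-- `σ_D(π) = π`. [folklore] -/
theorem σDr_πS : C.σDr e hj hje (algebraMap (C.A'' hj) (C.D₀ e hj hje) (C.πS hj)) = C.πO :=
  Subtype.ext (by rw [σDr_algebraMap, coe_πO]; exact C.ev_πK)

/-- `σ_D(x_Δ) = 0`. [folklore] -/
theorem σDr_xΔ : C.σDr e hj hje (C.xΔ e hj hje hBw) = 0 := by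
  have h := congrArg (C.σDr e hj hje) (C.xΔ_spec e hj hje hBw)
  rw [C.σDr_Δw, map_mul, map_pow, σDr_πS] at h
  exact C.pow_πO_mul_eq_zero h.symm

variable (r : ℕ) (hjW : C.Bw + (C.N₀ + r + C.dΘ) ≤ j)

/-- **The Newton coordinate of the polydisc chart inside the Hensel chart**:
`W_D = (w′ − w₀′)·ι₀/π^{N₀+r} ∈ D₀`, given as the honest element
`π^{j−B_w−N₀−r−d_Θ} · x_Δ · θ₀(ι₀)`. [folklore] -/
def WD : C.D₀ e hj hje :=
  algebraMap (C.A'' hj) (C.D₀ e hj hje) (C.πS hj) ^ (j - C.Bw - (C.N₀ + r + C.dΘ)) *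
    C.xΔ e hj hje hBw * C.θ₀ e hj hje C.ι₀_isIntegral

include hjW in
/-- **(I′)** `π^{N₀+r+d_Θ} W_D = Δ_w · θ₀(ι₀)`. [folklore] -/
theorem WD_spec : algebraMap (C.A'' hj) (C.D₀ e hj hje) (C.πS hj) ^ (C.N₀ + r + C.dΘ) * C.WD e hj hje hBw r =
    C.Δw e hj hje hBw * C.θ₀ e hj hje C.ι₀_isIntegral := by
  rw [WD, C.xΔ_spec, ← mul_assoc, ← mul_assoc, ← pow_add,
    show C.N₀ + r + C.dΘ + (j - C.Bw - (C.N₀ + r + C.dΘ)) = j - C.Bw by omega]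

/-- `σ_D(W_D) = 0` — the Newton coordinate vanishes at the point. [folklore] -/
theorem σDr_WD : C.σDr e hj hje (C.WD e hj hje hBw r) = 0 := by
  rw [WD, map_mul, map_mul, C.σDr_xΔ, mul_zero, zero_mul]

/-- `Ξ` of nonzero elements are units of `Ω_D`. [folklore] -/
theorem isUnit_Ξ {a : m} (ha : a ≠ 0) : IsUnit (C.Ξ e hj hje a) := (IsUnit.mk0 a ha).map _

/-- `ι_D(π) = Ξ(π)`. [folklore] -/
theorem ιD_πS : C.ιD e hj hje (algebraMap (C.A'' hj) (C.D₀ e hj hje) (C.πS hj)) =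
    C.Ξ e hj hje (algebraMap k m C.π) := by
  rw [← C.ιK_coe, C.Ξ_algebraMap]; rfl

include hjW in
/-- **(b)** `π^r Ξ(c₀′) ι_D(W_D) = ι_K(w′) − Ξ(w₀′)` in `Ω_D`: the Newton coordinate relates the
two images of the generator. [folklore] -/
theorem ιD_WD : C.Ξ e hj hje (algebraMap k m C.π) ^ r * C.Ξ e hj hje C.c₀' * C.ιD e hj hje (C.WD e hj hje hBw r) =
    C.ιK e hj hje (C.w' : K) - C.Ξ e hj hje C.w₀' := by
  have h := congrArg (C.ιD e hj hje) (C.WD_spec e hj hje hBw r hjW)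
  rw [map_mul, map_mul, map_pow, C.ιD_πS, C.ιD_Δw, C.ιD_θ₀, map_mul, map_pow, map_mul, map_pow,
    show C.ιK e hj hje C.πK = C.Ξ e hj hje (algebraMap k m C.π) from by rw [πK, ← C.Ξ_algebraMap]] at h
  have hc : C.Ξ e hj hje C.c₀' * C.Ξ e hj hje C.ι₀ = C.Ξ e hj hje (algebraMap k m C.π) ^ C.N₀ := by
    rw [← map_mul, C.c₀'_mul_ι₀, map_pow]
  set p := C.Ξ e hj hje (algebraMap k m C.π)
  have hu : IsUnit (p ^ (C.N₀ + C.dΘ)) := (C.isUnit_Ξ e hj hje ((_root_.map_ne_zero _).mpr C.hπ0)).pow _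
  refine hu.mul_left_cancel ?_
  rw [pow_add] at h ⊢
  linear_combination C.Ξ e hj hje C.c₀' * h + p ^ C.dΘ *
    (C.ιK e hj hje (C.w' : K) - C.Ξ e hj hje C.w₀') * hc

end MSide

end DecompChart


end Literature.AlgebraicGeometry.Resolution
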